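import Summits.Langlands.Langlands.Theorems.SqrtFiveQuarticCoversJInSqrtFiveModular
import Summits.Langlands.Langlands.Theses.SqrtFiveQuarticCovers

/-!
# Route `SqrtFiveQuarticCovers`, crux `RefinedLocusModular` (stmt-Langlands-17833), line `birth`:
# the four registered stubs `stub_H12_b7`, `stub_H8_b7`, `stub_H12_e7`, `stub_H8_e7` from the
# route's five certificate CHILDREN and the two printed bridge facts

The registered skeleton `Cruxes/RefinedLocusModular/Lines/birth.lean` (2026-08-17) cuts the crux along
`{H12, H8} × {b7, e7}` (mod-`5` image × mod-`7` image, the mod-`3` alternative `b3 ∨ C_s⁺(3)` kept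
inside each stub).  The route was later SPLIT on the ledger (rev 7, 2026-08-28) along a DIFFERENT cut,
the five certificate children `CertB3H8` (stmt-Langlands-23413), `CertH12B7` (23414), `CertS3H8`
(23415), `CertB3E7` (23416), `CertS3H12` (23417) — each «image hypotheses ⇒ geometric CM ∨
j(E) ∈ ℚ(√5)» — glued to the crux modulo the printed bridge `FLS2015_theorem1` + soluble base change
(`refinedLocusModularGlue_of_facts`, `…Sheets.lean`; RECORD v5 `…RecordWeak5.lean` feeds the children
from 12 named inputs).

This file records, kernel-checked, how the OLD cut sits over the NEW one — each registered stub
signature VERBATIM as the conclusion: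
* `stub_H12_b7` ⇐ `CertH12B7` (mod-`3` free);
* `stub_H8_b7`  ⇐ `CertB3H8` (case `b3`, with `b7`) and `CertS3H8` (case `s3`, mod-`7` free);
* `stub_H12_e7` ⇐ `CertB3E7` (case `b3`, mod-`5` free) and `CertS3H12` (case `s3`, mod-`7` free);
* `stub_H8_e7`  ⇐ `CertB3H8` (case `b3`, with `e7`) and `CertS3H8` (case `s3`);
plus, in every case, the bridge «CM ∨ j ∈ ℚ(√5) ⇒ modular» (`modular_of_hasCM_or_jInSqrtFive`, from the
tree's `jInSqrtFive_modular_of_facts`).  So a by-name closure of any of the four stubs needs nothing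
beyond the named child items it lists here and the two bridge facts.

HONEST STATUS: CONDITIONAL bookkeeping (hypotheses = open child items of the ledger + two printed
automorphy theorems as named facts); closes no stub by name and proves modularity of no curve.
Helper of stmt-Langlands-17833 (`--supports`).

References: [Box2022] §7.1 (the sixteen-curve programme), [FreitasLeHungSiksek2015] Thm. 1, §7,
[Thorne2016] Lemma 7.1.
-/

set_option linter.dupNamespace false -- project-wide option; `Summit.Langlands.Langlands` is the mandated namespace

noncomputable section

namespace Summit.Langlands.Langlands.Theorems.SqrtFiveQuarticCovers

open scoped NumberField Matrix
open Literature.NumberTheory.Automorphic Summit.Langlands.Langlands.Theses.SqrtFiveQuarticCovers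

/-- **The bridge of every certificate child**: over a totally real quartic `K ∋ √5`, «geometric CM ∨
`c₄³ = (a + b√5)·Δ` with `a b : ℚ`» implies modularity in the trace-only sense — CM is the first
alternative of `IsModularEllipticCurve`, and `j ∈ ℚ(√5)` is the tree's `jInSqrtFive_modular_of_facts`
(FLS 2015 Thm. 1 + soluble base change as named facts; twist invariance proved).
[cite: FreitasLeHungSiksek2015, Thm. 1 and §7] [cite: Thorne2016, Lemma 7.1] -/
theorem modular_of_hasCM_or_jInSqrtFive (hFLS : FLS2015_theorem1)
    (hBC : isModularEllipticCurve_baseChange_of_isSolvable_of_isAutomorphicOfWeightZero)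
    (K : Type) [Field K] [NumberField K] (hK : NumberField.IsTotallyReal K) (hd : Module.finrank ℚ K = 4)
    (hr : ∃ r : K, r ^ 2 = 5) (E : WeierstrassCurve (NumberField.RingOfIntegers K)) (hΔ : E.Δ ≠ 0)
    (h : (E.baseChange K).HasCM ∨
      (∃ r : K, r ^ 2 = 5 ∧ ∃ a b : ℚ, (E.baseChange K).c₄ ^ 3 = ((a : K) + (b : K) * r) * (E.baseChange K).Δ)) :
    IsModularEllipticCurve K E := by
  rcases h with hCM | hj
  · exact Or.inl hCM
  · exact jInSqrtFive_modular_of_facts hFLS hBC K hK hd hr E hΔ hj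

/-- **Registered stub `stub_H12_b7` (mod-`5` image in `H12`, mod-`7` Borel) from the child
`CertH12B7` (stmt-Langlands-23414) and the bridge facts.**  Conclusion = the registered signature
verbatim; the mod-`3` hypothesis is not used (the child is mod-`3` free). CONDITIONAL.
[cite: Box2022, §7.1] -/
theorem stub_H12_b7_of_certH12B7 (hFLS : FLS2015_theorem1)
    (hBC : isModularEllipticCurve_baseChange_of_isSolvable_of_isAutomorphicOfWeightZero)
    (hB7 : CertH12B7) :
    ∀ (K : Type) [Field K] [NumberField K], NumberField.IsTotallyReal K → Module.finrank ℚ K = 4 → (∃ r : K, r ^ 2 = 5) → ∀ E : WeierstrassCurve (NumberField.RingOfIntegers K), E.Δ ≠ 0 → (∃ ρ : Literature.NumberTheory.GaloisRepresentations.FramedGaloisRep K (ZMod 3) 2, (∃ e : (E.baseChange K).geomTorsion ((3 : ℕ) : ℤ) ≃+ (Fin 2 → ZMod 3), ∀ (σ : Field.absoluteGaloisGroup K) (P : (E.baseChange K).geomTorsion ((3 : ℕ) : ℤ)), e (σ • P) = ((ρ σ : GL (Fin 2) (ZMod 3)) : Matrix (Fin 2) (Fin 2) (ZMod 3)) *ᵥ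 (e P)) ∧ ((∀ σ : Field.absoluteGaloisGroup K, (((ρ σ : GL (Fin 2) (ZMod 3)) : Matrix (Fin 2) (Fin 2) (ZMod 3)) 1 0 = 0)) ∨ (∀ σ : Field.absoluteGaloisGroup K, (ρ σ : GL (Fin 2) (ZMod 3)) ∈ Subgroup.closure ({(⟨!![1, 0; 0, 2], !![1, 0; 0, 2], by decide, by decide⟩ : GL (Fin 2) (ZMod 3)), (⟨!![0, 1; 1, 0], !![0, 1; 1, 0], by decide, by decide⟩ : GL (Fin 2) (ZMod 3))} : Set (GL (Fin 2) (ZMod 3)))))) → (∃ ρ : Literature.NumberTheory.GaloisRepresentations.FramedGaloisRep K (ZMod 5) 2, (∃ e : (E.baseChange K).geomTorsion ((5 : ℕ) : ℤ) ≃+ (Fin 2 → ZMod 5), ∀ (σ : Field.absoluteGaloisGroup K) (P : (E.baseChange K).geomTorsion ((5 : ℕ) : ℤ)), e (σ • P) = ((ρ σ : GL (Fin 2) (ZMod 5)) : Matrix (Fin 2) (Fin 2) (ZMod 5)) *ᵥ (e P)) ∧ (∀ σ : Field.absoluteGaloisGroup K, (ρ σ : GL (Fin 2) (ZMod 5)) ∈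 Subgroup.closure ({(⟨!![3, 1; 3, 3], !![3, 4; 2, 3], by decide, by decide⟩ : GL (Fin 2) (ZMod 5)), (⟨!![1, 0; 0, 4], !![1, 0; 0, 4], by decide, by decide⟩ : GL (Fin 2) (ZMod 5))} : Set (GL (Fin 2) (ZMod 5))))) → (∃ ρ : Literature.NumberTheory.GaloisRepresentations.FramedGaloisRep K (ZMod 7) 2, (∃ e : (E.baseChange K).geomTorsion ((7 : ℕ) : ℤ) ≃+ (Fin 2 → ZMod 7), ∀ (σ : Field.absoluteGaloisGroup K) (P : (E.baseChange K).geomTorsion ((7 : ℕ) : ℤ)), e (σ • P) = ((ρ σ : GL (Fin 2) (ZMod 7)) : Matrix (Fin 2) (Fin 2) (ZMod 7)) *ᵥ (e P)) ∧ (∀ σ : Field.absoluteGaloisGroup K, (((ρ σ : GL (Fin 2) (ZMod 7)) : Matrix (Fin 2) (Fin 2) (ZMod 7)) 1 0 = 0))) → ((E.baseChange K).HasCM ∨ ∃ (hF : Literature.NumberTheory.Automorphic.isCompact_glFiniteIntegralLevel 2 K) (π : Literature.NumberTheory.Automorphic.CuspidalAutomorphicRepData 2 K hF), π.1.HasWeightZero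 ∧ ∀ᶠ w : IsDedekindDomain.HeightOneSpectrum (NumberField.RingOfIntegers K) in Filter.cofinite, ∃ α : Multiset ℂ, π.1.HasSatakeParamAt w α ∧ ((Real.sqrt w.residueCard : ℝ) : ℂ) * α.sum = (Literature.NumberTheory.Automorphic.frobTraceAt E w : ℂ)) := by
  intro K _ _ hK hd hr E hΔ _h3 h5 h7
  exact modular_of_hasCM_or_jInSqrtFive hFLS hBC K hK hd hr E hΔ (hB7 K hK hd hr E hΔ h5 h7)

/-- **Registered stub `stub_H8_b7` (mod-`5` image in `H8`, mod-`7` Borel) from the children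
`CertB3H8` (stmt-Langlands-23413; case `b3`, fed the `b7` disjunct) and `CertS3H8`
(stmt-Langlands-23415; case `C_s⁺(3)`) and the bridge facts.**  Conclusion = the registered signature
verbatim. CONDITIONAL. [cite: Box2022, §7.1] -/
theorem stub_H8_b7_of_certs (hFLS : FLS2015_theorem1)
    (hBC : isModularEllipticCurve_baseChange_of_isSolvable_of_isAutomorphicOfWeightZero)
    (hA : CertB3H8) (hC : CertS3H8) :
    ∀ (K : Type) [Field K] [NumberField K], NumberField.IsTotallyReal K → Module.finrank ℚ K = 4 → (∃ r : K, r ^ 2 = 5) → ∀ E : WeierstrassCurve (NumberField.RingOfIntegers K), E.Δ ≠ 0 → (∃ ρ : Literature.NumberTheory.GaloisRepresentations.FramedGaloisRep K (ZMod 3) 2, (∃ e : (E.baseChange K).geomTorsion ((3 : ℕ) : ℤ) ≃+ (Fin 2 → ZMod 3), ∀ (σ : Field.absoluteGaloisGroup K) (P : (E.baseChange K).geomTorsion ((3 : ℕ) : ℤ)), e (σ • P) = ((ρ σ : GL (Fin 2) (ZMod 3)) : Matrix (Fin 2) (Fin 2) (ZMod 3)) *ᵥ (e P)) ∧ ((∀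 σ : Field.absoluteGaloisGroup K, (((ρ σ : GL (Fin 2) (ZMod 3)) : Matrix (Fin 2) (Fin 2) (ZMod 3)) 1 0 = 0)) ∨ (∀ σ : Field.absoluteGaloisGroup K, (ρ σ : GL (Fin 2) (ZMod 3)) ∈ Subgroup.closure ({(⟨!![1, 0; 0, 2], !![1, 0; 0, 2], by decide, by decide⟩ : GL (Fin 2) (ZMod 3)), (⟨!![0, 1; 1, 0], !![0, 1; 1, 0], by decide, by decide⟩ : GL (Fin 2) (ZMod 3))} : Set (GL (Fin 2) (ZMod 3)))))) → (∃ ρ : Literature.NumberTheory.GaloisRepresentations.FramedGaloisRep K (ZMod 5) 2, (∃ e : (E.baseChange K).geomTorsion ((5 : ℕ) : ℤ) ≃+ (Fin 2 → ZMod 5), ∀ (σ : Field.absoluteGaloisGroup K) (P : (E.baseChange K).geomTorsion ((5 : ℕ) : ℤ)), e (σ • P) = ((ρ σ : GL (Fin 2) (ZMod 5)) : Matrix (Fin 2) (Fin 2) (ZMod 5)) *ᵥ (e P)) ∧ (∀ σ : Field.absoluteGaloisGroup K, (ρ σ : GL (Fin 2) (ZMod 5)) ∈ Subgroup.closure ({(⟨!![2,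 0; 0, 3], !![3, 0; 0, 2], by decide, by decide⟩ : GL (Fin 2) (ZMod 5)), (⟨!![0, 1; 1, 0], !![0, 1; 1, 0], by decide, by decide⟩ : GL (Fin 2) (ZMod 5))} : Set (GL (Fin 2) (ZMod 5))))) → (∃ ρ : Literature.NumberTheory.GaloisRepresentations.FramedGaloisRep K (ZMod 7) 2, (∃ e : (E.baseChange K).geomTorsion ((7 : ℕ) : ℤ) ≃+ (Fin 2 → ZMod 7), ∀ (σ : Field.absoluteGaloisGroup K) (P : (E.baseChange K).geomTorsion ((7 : ℕ) : ℤ)), e (σ • P) = ((ρ σ : GL (Fin 2) (ZMod 7)) : Matrix (Fin 2) (Fin 2) (ZMod 7)) *ᵥ (e P)) ∧ (∀ σ : Field.absoluteGaloisGroup K, (((ρ σ : GL (Fin 2) (ZMod 7)) : Matrix (Fin 2) (Fin 2) (ZMod 7)) 1 0 = 0))) → ((E.baseChange K).HasCM ∨ ∃ (hF : Literature.NumberTheory.Automorphic.isCompact_glFiniteIntegralLevel 2 K) (π : Literature.NumberTheory.Automorphic.CuspidalAutomorphicRepData 2 K hF), π.1.HasWeightZero ∧ ∀ᶠ w : IsDedekindDomain.HeightOneSpectrum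 (NumberField.RingOfIntegers K) in Filter.cofinite, ∃ α : Multiset ℂ, π.1.HasSatakeParamAt w α ∧ ((Real.sqrt w.residueCard : ℝ) : ℂ) * α.sum = (Literature.NumberTheory.Automorphic.frobTraceAt E w : ℂ)) := by
  intro K _ _ hK hd hr E hΔ h3 h5 h7
  obtain ⟨ρ3, e3, hb3 | hs3⟩ := h3
  · obtain ⟨ρ7, e7, hb7⟩ := h7
    exact modular_of_hasCM_or_jInSqrtFive hFLS hBC K hK hd hr E hΔ
      (hA K hK hd hr E hΔ ⟨ρ3, e3, hb3⟩ h5 (Or.inl ⟨ρ7, e7, hb7⟩))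
  · exact modular_of_hasCM_or_jInSqrtFive hFLS hBC K hK hd hr E hΔ
      (hC K hK hd hr E hΔ ⟨ρ3, e3, hs3⟩ h5)

/-- **Registered stub `stub_H12_e7` (mod-`5` image in `H12`, mod-`7` image in `G(e7)`) from the
children `CertB3E7` (stmt-Langlands-23416; case `b3`, mod-`5` free) and `CertS3H12`
(stmt-Langlands-23417; case `C_s⁺(3)`, mod-`7` free) and the bridge facts.**  Conclusion = the
registered signature verbatim. CONDITIONAL. [cite: Box2022, §7.1] -/
theorem stub_H12_e7_of_certs (hFLS : FLS2015_theorem1)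
    (hBC : isModularEllipticCurve_baseChange_of_isSolvable_of_isAutomorphicOfWeightZero)
    (hE : CertB3E7) (hD : CertS3H12) :
    ∀ (K : Type) [Field K] [NumberField K], NumberField.IsTotallyReal K → Module.finrank ℚ K = 4 → (∃ r : K, r ^ 2 = 5) → ∀ E : WeierstrassCurve (NumberField.RingOfIntegers K), E.Δ ≠ 0 → (∃ ρ : Literature.NumberTheory.GaloisRepresentations.FramedGaloisRep K (ZMod 3) 2, (∃ e : (E.baseChange K).geomTorsion ((3 : ℕ) : ℤ) ≃+ (Fin 2 → ZMod 3), ∀ (σ : Field.absoluteGaloisGroup K) (P : (E.baseChange K).geomTorsion ((3 : ℕ) : ℤ)), e (σ • P) = ((ρ σ : GL (Fin 2) (ZMod 3)) : Matrix (Fin 2) (Fin 2) (ZMod 3)) *ᵥ (e P)) ∧ ((∀ σ : Field.absoluteGaloisGroup K, (((ρ σ : GL (Fin 2) (ZMod 3)) : Matrix (Fin 2) (Fin 2) (ZMod 3)) 1 0 = 0)) ∨ (∀ σ : Field.absoluteGaloisGroup K, (ρ σ : GL (Fin 2) (ZMod 3)) ∈ Subgroup.closure ({(⟨!![1, 0;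 0, 2], !![1, 0; 0, 2], by decide, by decide⟩ : GL (Fin 2) (ZMod 3)), (⟨!![0, 1; 1, 0], !![0, 1; 1, 0], by decide, by decide⟩ : GL (Fin 2) (ZMod 3))} : Set (GL (Fin 2) (ZMod 3)))))) → (∃ ρ : Literature.NumberTheory.GaloisRepresentations.FramedGaloisRep K (ZMod 5) 2, (∃ e : (E.baseChange K).geomTorsion ((5 : ℕ) : ℤ) ≃+ (Fin 2 → ZMod 5), ∀ (σ : Field.absoluteGaloisGroup K) (P : (E.baseChange K).geomTorsion ((5 : ℕ) : ℤ)), e (σ • P) = ((ρ σ : GL (Fin 2) (ZMod 5)) : Matrix (Fin 2) (Fin 2) (ZMod 5)) *ᵥ (e P)) ∧ (∀ σ : Field.absoluteGaloisGroup K, (ρ σ : GL (Fin 2) (ZMod 5)) ∈ Subgroup.closure ({(⟨!![3, 1; 3, 3], !![3, 4; 2, 3], by decide, by decide⟩ : GL (Fin 2) (ZMod 5)), (⟨!![1, 0; 0, 4], !![1, 0; 0, 4], by decide, by decide⟩ : GL (Fin 2) (ZMod 5))} : Set (GL (Fin 2) (ZMod 5))))) → (∃ ρ : Literature.NumberTheory.GaloisRepresentations.FramedGaloisRep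 K (ZMod 7) 2, (∃ e : (E.baseChange K).geomTorsion ((7 : ℕ) : ℤ) ≃+ (Fin 2 → ZMod 7), ∀ (σ : Field.absoluteGaloisGroup K) (P : (E.baseChange K).geomTorsion ((7 : ℕ) : ℤ)), e (σ • P) = ((ρ σ : GL (Fin 2) (ZMod 7)) : Matrix (Fin 2) (Fin 2) (ZMod 7)) *ᵥ (e P)) ∧ (∀ σ : Field.absoluteGaloisGroup K, (ρ σ : GL (Fin 2) (ZMod 7)) ∈ Subgroup.closure ({(⟨!![0, 5; 3, 0], !![0, 5; 3, 0], by decide, by decide⟩ : GL (Fin 2) (ZMod 7)), (⟨!![5, 0; 3, 2], !![3, 0; 6, 4], by decide, by decide⟩ : GL (Fin 2) (ZMod 7))} : Set (GL (Fin 2) (ZMod 7))))) → ((E.baseChange K).HasCM ∨ ∃ (hF : Literature.NumberTheory.Automorphic.isCompact_glFiniteIntegralLevel 2 K) (π : Literature.NumberTheory.Automorphic.CuspidalAutomorphicRepData 2 K hF), π.1.HasWeightZero ∧ ∀ᶠ w : IsDedekindDomain.HeightOneSpectrum (NumberField.RingOfIntegers K) in Filter.cofinite, ∃ α : Multiset ℂ,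 π.1.HasSatakeParamAt w α ∧ ((Real.sqrt w.residueCard : ℝ) : ℂ) * α.sum = (Literature.NumberTheory.Automorphic.frobTraceAt E w : ℂ)) := by
  intro K _ _ hK hd hr E hΔ h3 h5 h7
  obtain ⟨ρ3, e3, hb3 | hs3⟩ := h3
  · exact modular_of_hasCM_or_jInSqrtFive hFLS hBC K hK hd hr E hΔ
      (hE K hK hd hr E hΔ ⟨ρ3, e3, hb3⟩ h7)
  · exact modular_of_hasCM_or_jInSqrtFive hFLS hBC K hK hd hr E hΔ
      (hD K hK hd hr E hΔ ⟨ρ3, e3, hs3⟩ h5)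

/-- **Registered stub `stub_H8_e7` (mod-`5` image in `H8`, mod-`7` image in `G(e7)`) — the
skeleton's hardest stub — from the children `CertB3H8` (stmt-Langlands-23413; case `b3`, fed the
`e7` disjunct) and `CertS3H8` (stmt-Langlands-23415; case `C_s⁺(3)`) and the bridge facts.**
Conclusion = the registered signature verbatim. CONDITIONAL. [cite: Box2022, §7.1] -/
theorem stub_H8_e7_of_certs (hFLS : FLS2015_theorem1)
    (hBC : isModularEllipticCurve_baseChange_of_isSolvable_of_isAutomorphicOfWeightZero)
    (hA : CertB3H8) (hC : CertS3H8) :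
    ∀ (K : Type) [Field K] [NumberField K], NumberField.IsTotallyReal K → Module.finrank ℚ K = 4 → (∃ r : K, r ^ 2 = 5) → ∀ E : WeierstrassCurve (NumberField.RingOfIntegers K), E.Δ ≠ 0 → (∃ ρ : Literature.NumberTheory.GaloisRepresentations.FramedGaloisRep K (ZMod 3) 2, (∃ e : (E.baseChange K).geomTorsion ((3 : ℕ) : ℤ) ≃+ (Fin 2 → ZMod 3), ∀ (σ : Field.absoluteGaloisGroup K) (P : (E.baseChange K).geomTorsion ((3 : ℕ) : ℤ)), e (σ • P) = ((ρ σ : GL (Fin 2) (ZMod 3)) : Matrix (Fin 2) (Fin 2) (ZMod 3)) *ᵥ (e P)) ∧ ((∀ σ : Field.absoluteGaloisGroup K, (((ρ σ : GL (Fin 2) (ZMod 3)) : Matrix (Fin 2) (Fin 2) (ZMod 3)) 1 0 = 0)) ∨ (∀ σ : Field.absoluteGaloisGroup K, (ρ σ : GL (Fin 2) (ZMod 3)) ∈ Subgroup.closure ({(⟨!![1, 0; 0, 2], !![1, 0; 0, 2], by decide, by decide⟩ : GL (Fin 2) (ZMod 3)), (⟨!![0, 1; 1, 0], !![0, 1;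 1, 0], by decide, by decide⟩ : GL (Fin 2) (ZMod 3))} : Set (GL (Fin 2) (ZMod 3)))))) → (∃ ρ : Literature.NumberTheory.GaloisRepresentations.FramedGaloisRep K (ZMod 5) 2, (∃ e : (E.baseChange K).geomTorsion ((5 : ℕ) : ℤ) ≃+ (Fin 2 → ZMod 5), ∀ (σ : Field.absoluteGaloisGroup K) (P : (E.baseChange K).geomTorsion ((5 : ℕ) : ℤ)), e (σ • P) = ((ρ σ : GL (Fin 2) (ZMod 5)) : Matrix (Fin 2) (Fin 2) (ZMod 5)) *ᵥ (e P)) ∧ (∀ σ : Field.absoluteGaloisGroup K, (ρ σ : GL (Fin 2) (ZMod 5)) ∈ Subgroup.closure ({(⟨!![2, 0; 0, 3], !![3, 0; 0, 2], by decide, by decide⟩ : GL (Fin 2) (ZMod 5)), (⟨!![0, 1; 1, 0], !![0, 1; 1, 0], by decide, by decide⟩ : GL (Fin 2) (ZMod 5))} : Set (GL (Fin 2) (ZMod 5))))) → (∃ ρ : Literature.NumberTheory.GaloisRepresentations.FramedGaloisRep K (ZMod 7) 2, (∃ e : (E.baseChange K).geomTorsion ((7 : ℕ) : ℤ) ≃+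 (Fin 2 → ZMod 7), ∀ (σ : Field.absoluteGaloisGroup K) (P : (E.baseChange K).geomTorsion ((7 : ℕ) : ℤ)), e (σ • P) = ((ρ σ : GL (Fin 2) (ZMod 7)) : Matrix (Fin 2) (Fin 2) (ZMod 7)) *ᵥ (e P)) ∧ (∀ σ : Field.absoluteGaloisGroup K, (ρ σ : GL (Fin 2) (ZMod 7)) ∈ Subgroup.closure ({(⟨!![0, 5; 3, 0], !![0, 5; 3, 0], by decide, by decide⟩ : GL (Fin 2) (ZMod 7)), (⟨!![5, 0; 3, 2], !![3, 0; 6, 4], by decide, by decide⟩ : GL (Fin 2) (ZMod 7))} : Set (GL (Fin 2) (ZMod 7))))) → ((E.baseChange K).HasCM ∨ ∃ (hF : Literature.NumberTheory.Automorphic.isCompact_glFiniteIntegralLevel 2 K) (π : Literature.NumberTheory.Automorphic.CuspidalAutomorphicRepData 2 K hF), π.1.HasWeightZero ∧ ∀ᶠ w : IsDedekindDomain.HeightOneSpectrum (NumberField.RingOfIntegers K) in Filter.cofinite, ∃ α : Multiset ℂ, π.1.HasSatakeParamAt w α ∧ ((Real.sqrt w.residueCard : ℝ) : ℂ) * α.sum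 = (Literature.NumberTheory.Automorphic.frobTraceAt E w : ℂ)) := by
  intro K _ _ hK hd hr E hΔ h3 h5 h7
  obtain ⟨ρ3, e3, hb3 | hs3⟩ := h3
  · obtain ⟨ρ7, e7, he7⟩ := h7
    exact modular_of_hasCM_or_jInSqrtFive hFLS hBC K hK hd hr E hΔ
      (hA K hK hd hr E hΔ ⟨ρ3, e3, hb3⟩ h5 (Or.inr ⟨ρ7, e7, he7⟩))
  · exact modular_of_hasCM_or_jInSqrtFive hFLS hBC K hK hd hr E hΔ
      (hC K hK hd hr E hΔ ⟨ρ3, e3, hs3⟩ h5)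

end Summit.Langlands.Langlands.Theorems.SqrtFiveQuarticCovers

end
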